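import Mathlib
import Summits.NavierStokesRegularity.NavierStokesRegularity.Theorems.FilamentSkeletonRssStadiumCornerRightFoot
import Summits.NavierStokesRegularity.NavierStokesRegularity.Theorems.FilamentSkeletonRssStadiumFootClosedForm

/-!
# Route `FilamentSkeletonRss` · child crux `TangentSkeletonNearStraightL` (stmt-NavierStokesRegularity-23320) · registered line
# `child_tangent_analytic_strip_L` (b0b56c52900dd90a), stub `stub_stripPropagation` — assembly: DESCENT SOURCES OF THE RIGHT CORNER BY THE FOOT ESTIMATE, REDUCED TO ONE NUMBER

Item R1 (continued) of the quarter-width blueprint (evidence `CORNER-QUARTER-BLUEPRINT-leafhand-15-g0.md` v5 on 23320).  For a target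
`z = x₀ + iY` of the right output corner region (`0 ≤ Y < hs/4`, `cc ≤ x₀ < cc + L + hs/4`) and a COMPLEX source `ζ = (x₀ + a) + iη` on the
descent of the contour (`0 < a < 3hs/4`, `0 ≤ η`), the two-feet estimate `Theorems.StadiumFootClosedForm.foot_re_ge_closed_form` (radii
`R₁ = 3hs/4` at the target foot, `R₂ = 3hs/4 − a` at the source foot, `‖F′‖ ≤ 2`, chord projection `c₀ = (1 − Rb²/2)a ≥ (7/8)a`) is
reduced to ONE explicit inequality between elementary closed forms at a WORST-CASE source height `ηs ≥ η` and a worst-case mixed term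
`Ss ≥ (Y−η)² + Yη/4`:
  `√Ss + 0.0389·hs + I(R₂,ηs) < (7/8)a − 0.0398·hs − J(R₂,ηs) − ½Q(R₂,ηs)  ⟹  0 < Re(Σᵢ (Fᵢ(ζ) − Fᵢ(z))² + κ·G)`
(`corner_descent_foot_re_pos_of_num`; `I`, `J`, `Q` the closed-form smears of `Theorems.StadiumLegProfiles` / `Theorems.StadiumFootClosedForm`
with `M = 2`; the target-leg numbers `0.0389`, `0.0398` are `Theorems.StadiumCornerRightFoot.corner_I_le / corner_J_le`; all smears are
monotone in the height — `legQ_closed_mono` here, `legI/legJ_closed_mono` there).  Every `Rb ≤ 1/2`.  What remains per descent piece is pure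
real arithmetic on `(a, ηs, Ss)`-ranges (hand's census: the straight descent of `Theorems.StadiumCornerRightNear` needs this tool on `f ≥ 0.52`
with relative margin `0.01–0.11`, the hybrid chord bound below that).
HONEST FRAMING: bookkeeping for a HYPOTHETICAL filament skeleton on the NEGATIVE side of a MODEL route; the stub `stub_stripPropagation` is NOT
closed by this file; nothing here bears on Navier–Stokes regularity or blow-up.  `--supports stmt-NavierStokesRegularity-23320`.
-/

set_option linter.dupNamespace false

noncomputable section

namespace Summit.NavierStokesRegularity.NavierStokesRegularity.Theorems.StadiumCornerRightDescentFoot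

open Set MeasureTheory
open scoped InnerProductSpace BigOperators
open Summit.NavierStokesRegularity.NavierStokesRegularity.Theorems.StadiumCornerRightFoot
open Summit.NavierStokesRegularity.NavierStokesRegularity.Theorems.StadiumFootClosedForm
open Summit.NavierStokesRegularity.NavierStokesRegularity.Theorems.StadiumChordProjection

/-- **The `Q`-smear is monotone in the height**: for `0 ≤ M`, `0 ≤ t₁ ≤ t₂ < R`,
`√3·M(t₁ − (R−t₁)log(R/(R−t₁))) ≤ √3·M(t₂ − (R−t₂)log(R/(R−t₂)))` (it is `∫₀ᵗ √3·M·log(R/(R−u)) du`). [folklore] -/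
theorem legQ_closed_mono {M R t₁ t₂ : ℝ} (hM : 0 ≤ M) (ht₁ : 0 ≤ t₁) (h12 : t₁ ≤ t₂) (ht₂ : t₂ < R) :
    √3 * (M * (t₁ - (R - t₁) * Real.log (R / (R - t₁)))) ≤ √3 * (M * (t₂ - (R - t₂) * Real.log (R / (R - t₂)))) := by
  have ht₁R : t₁ < R := lt_of_le_of_lt h12 ht₂
  have ht₂0 : 0 ≤ t₂ := ht₁.trans h12
  rw [← integral_log_ratio_eq ht₁ ht₁R, ← integral_log_ratio_eq ht₂0 ht₂]
  have hcont : ContinuousOn (fun u : ℝ => Real.log (R / (R - u))) (Icc 0 t₂) := continuousOn_log_ratio ht₂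
  have hint : ∀ a b, a ∈ Icc (0:ℝ) t₂ → b ∈ Icc (0:ℝ) t₂ →
      IntervalIntegrable (fun u : ℝ => Real.log (R / (R - u))) volume a b := by
    intro a b ha hb
    exact (hcont.mono (uIcc_subset_Icc ha hb)).intervalIntegrable
  have h0 : (0:ℝ) ∈ Icc (0:ℝ) t₂ := ⟨le_rfl, ht₂0⟩
  have h1 : t₁ ∈ Icc (0:ℝ) t₂ := ⟨ht₁, h12⟩
  have h2 : t₂ ∈ Icc (0:ℝ) t₂ := ⟨ht₂0, le_rfl⟩
  rw [← intervalIntegral.integral_add_adjacent_intervals (hint 0 t₁ h0 h1) (hint t₁ t₂ h1 h2)]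
  have hnn : 0 ≤ ∫ u in t₁..t₂, Real.log (R / (R - u)) := by
    refine intervalIntegral.integral_nonneg h12 fun u hu => ?_
    exact log_ratio_nonneg (ht₁.trans hu.1) (lt_of_le_of_lt hu.2 ht₂)
  have h3 : 0 ≤ Real.sqrt 3 := Real.sqrt_nonneg 3
  have : M * (∫ u in (0:ℝ)..t₁, Real.log (R / (R - u))) ≤
      M * ((∫ u in (0:ℝ)..t₁, Real.log (R / (R - u))) + ∫ u in t₁..t₂, Real.log (R / (R - u))) :=
    mul_le_mul_of_nonneg_left (by linarith) hM
  exact mul_le_mul_of_nonneg_left this h3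

/-- **Descent sources of the right corner by the foot estimate, reduced to one number.**  Stadium `S = {|Im| < hs, |Re − cc| < L + hs}`,
`F` holomorphic on `S` with `‖F′‖ ≤ 2`, `Σ (F′)ᵢ² = 1`, `F = cplx ∘ X` on the real trace, `X` of class `C¹` with unit speed and tangent
oscillation `≤ Rb ≤ 1/2`; target `z = x₀ + iY` (`0 ≤ Y < hs/4`, `cc ≤ x₀ < cc + L + hs/4`); source `ζ = (x₀ + a) + iη` with `0 < a`,
`0 ≤ η ≤ ηs < 3hs/4 − a =: R₂`; a bound `(Y−η)² + Yη/4 ≤ Ss`; core term `0 < κ`, `0 < g₀ ≤ Re G`.  If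
`√Ss + 0.0389hs + √3·4(ηs − (R₂−ηs)ℓ − ηs²/(2R₂)) < (7/8)a − 0.0398hs − 24·K(R₂,ηs) − ½·√3·2(ηs − (R₂−ηs)ℓ)` (`ℓ = log(R₂/(R₂−ηs))`,
`K` the `J`-closed form), then `0 < Re(Σᵢ (Fᵢ(ζ) − Fᵢ(z))² + κ·G)`. [folklore] -/
theorem corner_descent_foot_re_pos_of_num {hs L cc : ℝ} {F : ℂ → (Fin 3 → ℂ)}
    (hF : DifferentiableOn ℂ F {z : ℂ | |z.im| < hs ∧ |z.re - cc| < L + hs})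
    (hM : ∀ z ∈ {z : ℂ | |z.im| < hs ∧ |z.re - cc| < L + hs}, ‖deriv F z‖ ≤ 2)
    (hunit : ∀ w ∈ {z : ℂ | |z.im| < hs ∧ |z.re - cc| < L + hs}, ∑ i, (deriv F w i) ^ 2 = 1)
    {X : ℝ → EuclideanSpace ℝ (Fin 3)} (hX : ContDiff ℝ 1 X) (hXu : ∀ τ, ‖deriv X τ‖ = 1)
    {Rb : ℝ} (hRb0 : 0 ≤ Rb) (hRb : Rb ≤ 1 / 2) (hosc : ∀ τ σ, ‖deriv X τ - deriv X σ‖ ≤ Rb)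
    (hFX : ∀ r : ℝ, (r : ℂ) ∈ {z : ℂ | |z.im| < hs ∧ |z.re - cc| < L + hs} →
      F r = fun i => ((⟪X r, EuclideanSpace.single i (1:ℝ)⟫_ℝ : ℝ) : ℂ))
    (hhs : 0 < hs) {x₀ Y a η ηs Ss : ℝ} (hY0 : 0 ≤ Y) (hY : Y < hs / 4) (hx₀ : x₀ < cc + L + hs / 4) (hx₀cc : cc ≤ x₀)
    (ha0 : 0 < a) (hη0 : 0 ≤ η) (hηs : η ≤ ηs) (hηsR : ηs < 3 * hs / 4 - a)
    (hSs : (Y - η) ^ 2 + Y * η / 4 ≤ Ss)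
    (hnum : √Ss + 0.0389 * hs +
        √3 * (2 * 2 * (ηs - (3 * hs / 4 - a - ηs) * Real.log ((3 * hs / 4 - a) / (3 * hs / 4 - a - ηs)) -
          ηs ^ 2 / (2 * (3 * hs / 4 - a)))) <
      7 / 8 * a - 0.0398 * hs -
        (6 * (2:ℝ) ^ 2 * (2 * ηs - (3 * hs / 4 - a - ηs) * Real.log ((3 * hs / 4 - a) / (3 * hs / 4 - a - ηs)) ^ 2 -
            2 * (3 * hs / 4 - a - ηs) * Real.log ((3 * hs / 4 - a) / (3 * hs / 4 - a - ηs)) +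
            ((3 * hs / 4 - a) ^ 2 - ηs ^ 2) * Real.log ((3 * hs / 4 - a) / (3 * hs / 4 - a - ηs)) / (2 * (3 * hs / 4 - a)) -
            ηs / 2 - ηs ^ 2 / (4 * (3 * hs / 4 - a))) +
          1 / 2 * (√3 * (2 * (ηs - (3 * hs / 4 - a - ηs) * Real.log ((3 * hs / 4 - a) / (3 * hs / 4 - a - ηs)))))))
    {κ g₀ : ℝ} {Gv : ℂ} (hκ : 0 < κ) (hg₀ : 0 < g₀) (hG : g₀ ≤ Gv.re) :
    0 < ((∑ i, (F (((x₀ + a : ℝ) : ℂ) + (η : ℂ) * Complex.I) i - F ((x₀ : ℂ) + (Y : ℂ) * Complex.I) i) ^ 2) +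
      (κ : ℂ) * Gv).re := by
  have hXd : Differentiable ℝ X := hX.differentiable (by norm_num)
  -- the mixed term (small context first)
  have hRb2 : Rb ^ 2 ≤ 1 / 4 := by nlinarith
  have hmix : √((Y - η) ^ 2 + Y * η * Rb ^ 2) ≤ √Ss := by
    apply Real.sqrt_le_sqrt
    have hYη : 0 ≤ Y * η := mul_nonneg hY0 hη0
    have h1 : Y * η * Rb ^ 2 ≤ Y * η * (1 / 4) := mul_le_mul_of_nonneg_left hRb2 hYη
    linarith only [h1, hSs]
  have hmix0 : 0 ≤ √((Y - η) ^ 2 + Y * η * Rb ^ 2) := Real.sqrt_nonneg _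
  -- radii
  have hR₁Y : Y < 3 * hs / 4 := by linarith
  have hR₁hs : 3 * hs / 4 < hs := by linarith
  have hR₁end : |x₀ - cc| + 3 * hs / 4 < L + hs := by
    rw [abs_of_nonneg (by linarith)]; linarith
  have hηR₂ : η < 3 * hs / 4 - a := lt_of_le_of_lt hηs hηsR
  have hR₂hs : 3 * hs / 4 - a < hs := by linarith
  have hR₂end : |x₀ + a - cc| + (3 * hs / 4 - a) < L + hs := by
    rw [abs_of_nonneg (by linarith)]; linarith
  have hηs0 : 0 ≤ ηs := hη0.trans hηs
  -- chord projection `c₀ = (1 − Rb²/2)·a ≥ (7/8)a`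
  have hc₀ := chord_proj_coords_ge hX hXu hosc (x₁ := x₀) (x₂ := x₀ + a) (by linarith)
  have hc₀' : 7 / 8 * a ≤ (1 - Rb ^ 2 / 2) * (x₀ + a - x₀) := by
    have e : x₀ + a - x₀ = a := by ring
    rw [e]
    have h1 : 7 / 8 ≤ 1 - Rb ^ 2 / 2 := by nlinarith
    nlinarith
  -- target leg numbers
  have hI₁ := corner_I_le hhs hY0 hY.le
  have hJ₁ := corner_J_le hhs hY0 hY.le
  have hI₁0 : 0 ≤ √3 * (2 * 2 * (Y - (3 * hs / 4 - Y) * Real.log (3 * hs / 4 / (3 * hs / 4 - Y)) - Y ^ 2 / (2 * (3 * hs / 4)))) := by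
    have h := legI_closed_mono (M := 2) (R := 3 * hs / 4) (t₁ := 0) (t₂ := Y) (by norm_num) le_rfl hY0 hR₁Y
    have e : √3 * (2 * 2 * (0 - (3 * hs / 4 - 0) * Real.log (3 * hs / 4 / (3 * hs / 4 - 0)) - 0 ^ 2 / (2 * (3 * hs / 4)))) = 0 := by
      rw [sub_zero, div_self (by positivity : (3 * hs / 4) ≠ 0), Real.log_one]; ring
    rw [e] at h
    exact h
  -- source leg: monotone in the height up to `ηs`
  have hI₂ := legI_closed_mono (M := 2) (R := 3 * hs / 4 - a) (by norm_num) hη0 hηs hηsR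
  have hI₂0 : 0 ≤ √3 * (2 * 2 * (η - (3 * hs / 4 - a - η) * Real.log ((3 * hs / 4 - a) / (3 * hs / 4 - a - η)) -
      η ^ 2 / (2 * (3 * hs / 4 - a)))) := by
    have h := legI_closed_mono (M := 2) (R := 3 * hs / 4 - a) (t₁ := 0) (t₂ := η) (by norm_num) le_rfl hη0 hηR₂
    have e : √3 * (2 * 2 * (0 - (3 * hs / 4 - a - 0) * Real.log ((3 * hs / 4 - a) / (3 * hs / 4 - a - 0)) -
        0 ^ 2 / (2 * (3 * hs / 4 - a)))) = 0 := by
      rw [sub_zero, div_self (by linarith : (3 * hs / 4 - a) ≠ 0), Real.log_one]; ring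
    rw [e] at h
    exact h
  have hJ₂ := legJ_closed_mono (M := 2) (R := 3 * hs / 4 - a) hη0 hηs hηsR
  have hQ₂ := legQ_closed_mono (M := 2) (R := 3 * hs / 4 - a) (by norm_num) hη0 hηs hηsR
  have hQ₂0 : 0 ≤ √3 * (2 * (η - (3 * hs / 4 - a - η) * Real.log ((3 * hs / 4 - a) / (3 * hs / 4 - a - η)))) := by
    have h := legQ_closed_mono (M := 2) (R := 3 * hs / 4 - a) (t₁ := 0) (t₂ := η) (by norm_num) le_rfl hη0 hηR₂
    have e : √3 * (2 * (0 - (3 * hs / 4 - a - 0) * Real.log ((3 * hs / 4 - a) / (3 * hs / 4 - a - 0)))) = 0 := by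
      rw [sub_zero, div_self (by linarith : (3 * hs / 4 - a) ≠ 0), Real.log_one]; ring
    rw [e] at h
    exact h
  -- atomise all closed forms
  generalize hCv : (1 - Rb ^ 2 / 2) * (x₀ + a - x₀) = Cv at hc₀ hc₀'
  generalize hJ1v : 6 * (2:ℝ) ^ 2 * (2 * Y - (3 * hs / 4 - Y) * Real.log (3 * hs / 4 / (3 * hs / 4 - Y)) ^ 2 -
        2 * (3 * hs / 4 - Y) * Real.log (3 * hs / 4 / (3 * hs / 4 - Y)) +
        ((3 * hs / 4) ^ 2 - Y ^ 2) * Real.log (3 * hs / 4 / (3 * hs / 4 - Y)) / (2 * (3 * hs / 4)) - Y / 2 -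
        Y ^ 2 / (4 * (3 * hs / 4))) = J1v at hJ₁
  generalize hI1v : √3 * (2 * 2 * (Y - (3 * hs / 4 - Y) * Real.log (3 * hs / 4 / (3 * hs / 4 - Y)) -
      Y ^ 2 / (2 * (3 * hs / 4)))) = I1v at hI₁ hI₁0
  generalize hJ2v : 6 * (2:ℝ) ^ 2 * (2 * η - (3 * hs / 4 - a - η) * Real.log ((3 * hs / 4 - a) / (3 * hs / 4 - a - η)) ^ 2 -
        2 * (3 * hs / 4 - a - η) * Real.log ((3 * hs / 4 - a) / (3 * hs / 4 - a - η)) +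
        ((3 * hs / 4 - a) ^ 2 - η ^ 2) * Real.log ((3 * hs / 4 - a) / (3 * hs / 4 - a - η)) / (2 * (3 * hs / 4 - a)) -
        η / 2 - η ^ 2 / (4 * (3 * hs / 4 - a))) = J2v at hJ₂
  generalize hJ2s : 6 * (2:ℝ) ^ 2 * (2 * ηs - (3 * hs / 4 - a - ηs) * Real.log ((3 * hs / 4 - a) / (3 * hs / 4 - a - ηs)) ^ 2 -
        2 * (3 * hs / 4 - a - ηs) * Real.log ((3 * hs / 4 - a) / (3 * hs / 4 - a - ηs)) +
        ((3 * hs / 4 - a) ^ 2 - ηs ^ 2) * Real.log ((3 * hs / 4 - a) / (3 * hs / 4 - a - ηs)) / (2 * (3 * hs / 4 - a)) -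
        ηs / 2 - ηs ^ 2 / (4 * (3 * hs / 4 - a))) = J2s at hJ₂ hnum
  generalize hI2v : √3 * (2 * 2 * (η - (3 * hs / 4 - a - η) * Real.log ((3 * hs / 4 - a) / (3 * hs / 4 - a - η)) -
      η ^ 2 / (2 * (3 * hs / 4 - a)))) = I2v at hI₂ hI₂0
  generalize hI2s : √3 * (2 * 2 * (ηs - (3 * hs / 4 - a - ηs) * Real.log ((3 * hs / 4 - a) / (3 * hs / 4 - a - ηs)) -
      ηs ^ 2 / (2 * (3 * hs / 4 - a)))) = I2s at hI₂ hnum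
  generalize hQ2v : √3 * (2 * (η - (3 * hs / 4 - a - η) * Real.log ((3 * hs / 4 - a) / (3 * hs / 4 - a - η)))) = Q2v at hQ₂ hQ₂0
  generalize hQ2s : √3 * (2 * (ηs - (3 * hs / 4 - a - ηs) * Real.log ((3 * hs / 4 - a) / (3 * hs / 4 - a - ηs)))) = Q2s
    at hQ₂ hnum
  generalize hMv : √((Y - η) ^ 2 + Y * η * Rb ^ 2) = Mv at hmix hmix0
  -- the Rb-term of `J₂`
  have hRbQ : Rb * Q2v ≤ 1 / 2 * Q2s := by
    calc Rb * Q2v ≤ Rb * Q2s := mul_le_mul_of_nonneg_left hQ₂ hRb0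
      _ ≤ 1 / 2 * Q2s := mul_le_mul_of_nonneg_right hRb (hQ₂0.trans hQ₂)
  have hRbQ0 : 0 ≤ Rb * Q2v := mul_nonneg hRb0 hQ₂0
  have hJ₂0' : J2v ≤ J2s := hJ₂
  -- the gap
  have hSs0 : 0 ≤ √Ss := Real.sqrt_nonneg _
  have ha' : 0 ≤ Cv - J1v - (J2v + Rb * Q2v) := by
    linarith only [hSs0, hnum, hc₀', hJ₁, hJ₂0', hRbQ, hI₁0, hI₂0, hI₂, hhs]
  have h := foot_re_ge_closed_form (M := 2) hF hM hunit hXd hXu hosc hFX hhs hY0 hη0 hR₁Y hR₁hs hR₁end hηR₂ hR₂hs hR₂end hc₀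
    (by rw [hJ1v, hJ2v, hQ2v]; exact ha')
  rw [hJ1v, hJ2v, hQ2v, hI1v, hI2v, hMv] at h
  have hB0 : 0 ≤ Mv + I1v + I2v := by linarith only [hmix0, hI₁0, hI₂0]
  have hgap : Mv + I1v + I2v < Cv - J1v - (J2v + Rb * Q2v) := by
    linarith only [hSs0, hnum, hc₀', hJ₁, hJ₂0', hRbQ, hI₁, hI₂, hmix, hhs]
  have hsq : 0 < (Cv - J1v - (J2v + Rb * Q2v)) ^ 2 - (Mv + I1v + I2v) ^ 2 := by
    have e : (Cv - J1v - (J2v + Rb * Q2v)) ^ 2 - (Mv + I1v + I2v) ^ 2 =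
        ((Cv - J1v - (J2v + Rb * Q2v)) - (Mv + I1v + I2v)) * ((Cv - J1v - (J2v + Rb * Q2v)) + (Mv + I1v + I2v)) := by ring
    rw [e]
    exact mul_pos (by linarith only [hgap]) (by linarith only [hgap, hB0])
  -- orientation of the chord and the core term
  have hsym : (∑ i, (F (((x₀ + a : ℝ) : ℂ) + (η : ℂ) * Complex.I) i - F ((x₀ : ℂ) + (Y : ℂ) * Complex.I) i) ^ 2) =
      ∑ i, (F ((x₀ : ℂ) + (Y : ℂ) * Complex.I) i - F (((x₀ + a : ℝ) : ℂ) + (η : ℂ) * Complex.I) i) ^ 2 :=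
    Finset.sum_congr rfl fun i _ => by ring
  rw [Complex.add_re, hsym]
  have hκG : 0 < ((κ : ℂ) * Gv).re := by
    rw [Complex.re_ofReal_mul]
    exact mul_pos hκ (lt_of_lt_of_le hg₀ hG)
  push_cast at h ⊢
  linarith only [h, hsq, hκG]

end Summit.NavierStokesRegularity.NavierStokesRegularity.Theorems.StadiumCornerRightDescentFoot

end
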